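import Literature.Geometry.Riemannian.GromovW1Distance
import Literature.Geometry.Riemannian.WassersteinW1Triangle
import Mathlib.MeasureTheory.Measure.Support
import Mathlib.Topology.MetricSpace.Gluing
import HarnessLib

/-!
# The support space of a measure (Bamler 2023, §2.3–§2.4; §5.4, Lemma 5.20; §7.3)

R. Bamler, *Compactness theory of the space of super Ricci flows*, Invent. Math. 233 (2023), §2.3:
*"A triple `(X, d, μ)`, consisting of a complete and separable metric space `(X, d)` and a
probability measure `μ ∈ 𝒫(X)`, is called a (normalized) metric measure space. If `supp μ = X`,
then `(X, d, μ)` is said to have full support."*; §2.4, proof of the Proposition (`d_{GW_p}` is a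
pseudometric; arXiv v1 Proposition 14): *"consider first a metric measure space `(X, d, μ)` and let
`X' := supp μ`. Taking `Z := X` and considering the natural injections `X, X' → Z` allows us to
conclude that `d_{GW_p}((X, d, μ), (supp μ, d|_{supp μ}, μ|_{supp μ})) = 0`."* The restriction to
the support is how limits are normalised throughout the paper: §5.4, proof of Lemma 5.20 (arXiv
Lemma 121): *"Let `X^∞_t := supp μ^∞_t` and `d^∞_t := d^Z_t|_{X^∞_t}`. Then
`(X^∞_t, d^∞_t, μ^∞_t)` is a complete, separable metric measure space of full support."*; §7.3,
proof of the Lemma on Cauchy sequences within a correspondence (arXiv Lemma 161): *"where we may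
assume the limiting spaces to be separable, complete and of full support."*

This file provides that gadget in the tree's vocabulary. For a measure `μ` on a metric space `Z`
(Borel σ-algebra), `μ.support` is Mathlib's closed topological support
(`Mathlib/MeasureTheory/Measure/Support.lean`) and

* `supportMeasure μ : Measure μ.support` is `μ` pulled back to the subtype `μ.support`
  (`Measure.comap Subtype.val`), i.e. `μ|_{supp μ}` on `(supp μ, d|_{supp μ})`;
* `completeSpace_support`, `separableSpace_support`, `nonempty_support_of_isProbabilityMeasure` —
  the support is complete / separable / nonempty when `Z` is complete / separable / `μ` is a
  probability measure on a second-countable `Z`;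
* `supportMeasure_apply`, `map_val_supportMeasure : (supportMeasure μ).map Subtype.val = μ`
  (second-countable `Z`: `μ (supp μ)ᶜ = 0`), `lintegral_supportMeasure`, `ae_supportMeasure_iff`,
  `isFiniteMeasure_supportMeasure`, `isProbabilityMeasure_supportMeasure`;
* `isOpenPosMeasure_supportMeasure` — **full support**: `supp (μ|_{supp μ}) = supp μ`, phrased as
  `Measure.IsOpenPosMeasure` (the condition `MetricFlowPair.isOpenPosMeasure`);
* `gromovW1_supportMeasure : d_{GW₁}((X, ν), (supp μ, μ|_{supp μ})) = d_{GW₁}((X, ν), (Z, μ))`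
  (and `gromovW1_supportMeasure_left`) — passing to the support does not change
  Gromov–`W₁`–Wasserstein distances. Proof: an admissible pair of embeddings `φ : X → W`,
  `ψ : Z → W` for `(Z, μ)` restricts to the pair `φ`, `ψ ∘ Subtype.val` for the support with the
  same push-forwards; conversely, given `φ : X → W` and `ψ' : supp μ → W`, glue `W` and `Z` along
  `supp μ` (Bamler's Lemma (combining isometric embeddings); Mathlib's `Metric.GlueSpace`), so
  that `Z` embeds into the glued space compatibly with `ψ'`, and `d_{W₁}` does not increase under
  the isometric embedding of `W` into the glued space (`wassersteinW1_map_le_of_edist_le`).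

Everything is proved; the only definition is `supportMeasure`; no named facts.

## References

* R. H. Bamler, *Compactness theory of the space of super Ricci flows*, Invent. Math. 233 (2023),
  1121–1277 (arXiv:2008.09298), §2.3 (metric measure spaces, full support), §2.4, Proposition
  (`d_{GW_p}` is a pseudometric; `d_{GW_p}((X, d, μ), (supp μ, d|, μ|)) = 0`) and Lemma
  (combining isometric embeddings), §5.4, Lemma 5.20 (arXiv v1 Lemma 121), §7.3 (arXiv v1 Lemma
  161). [Bamler2023]
-/

noncomputable section

open Set MeasureTheory Filter TopologicalSpace Function
open scoped Topology ENNReal NNReal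

namespace Literature.Geometry.Riemannian

universe u

section SupportSpace

variable {Z : Type u} [MetricSpace Z] [MeasurableSpace Z]

/-- **The measure of a metric measure space restricted to its support**: for a measure `μ` on a
metric space `Z`, the measure `μ|_{supp μ}` on the closed subspace `supp μ ⊆ Z` (Mathlib's
`Measure.support`, as a subtype with the induced metric), i.e. `μ` pulled back along the inclusion
`Subtype.val : μ.support → Z`. Bamler 2023, §2.4: `(supp μ, d|_{supp μ}, μ|_{supp μ})`.
[cite: Bamler2023, §2.3 (metric measure spaces of full support)] -/
def supportMeasure (μ : Measure Z) : Measure μ.support :=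
  Measure.comap Subtype.val μ

/-! ### The support as a metric space -/

/-- The inclusion of the support is an isometric embedding. [folklore] -/
theorem isometry_subtype_val_support (μ : Measure Z) :
    Isometry (Subtype.val : μ.support → Z) :=
  isometry_subtype_coe

/-- The support of a measure on a complete metric space is complete (it is closed).
[cite: Bamler2023, §5.4, Lemma 5.20, proof ("a complete, separable metric measure space")] -/
instance completeSpace_support [CompleteSpace Z] (μ : Measure Z) : CompleteSpace μ.support :=
  μ.isClosed_support.completeSpace_coe

/-- The support of a measure on a separable metric space is separable.
[cite: Bamler2023, §5.4, Lemma 5.20, proof ("a complete, separable metric measure space")] -/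
instance separableSpace_support [SeparableSpace Z] (μ : Measure Z) : SeparableSpace μ.support :=
  (IsSeparable.of_separableSpace _).separableSpace

/-- The support of a non-zero measure on a second-countable space is nonempty. [folklore] -/
theorem nonempty_coe_support [SecondCountableTopology Z] {μ : Measure Z} (hμ : μ ≠ 0) :
    Nonempty μ.support :=
  (Measure.nonempty_support hμ).to_subtype

/-- The support of a probability measure on a second-countable space is nonempty. [folklore] -/
instance nonempty_support_of_isProbabilityMeasure [SecondCountableTopology Z] (μ : Measure Z)
    [IsProbabilityMeasure μ] : Nonempty μ.support :=
  nonempty_coe_support (IsProbabilityMeasure.ne_zero μ)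

/-! ### The restricted measure -/

section Borel

variable [BorelSpace Z]

/-- The support is a measurable (closed) set. [folklore] -/
theorem measurableSet_support (μ : Measure Z) : MeasurableSet μ.support :=
  μ.isClosed_support.measurableSet

/-- The inclusion of the support is a measurable embedding. [folklore] -/
theorem measurableEmbedding_subtype_val_support (μ : Measure Z) :
    MeasurableEmbedding (Subtype.val : μ.support → Z) :=
  MeasurableEmbedding.subtype_coe (measurableSet_support μ)

/-- `μ|_{supp μ}(s) = μ(s)` for `s ⊆ supp μ` (read in `Z`). [folklore] -/
theorem supportMeasure_apply (μ : Measure Z) (s : Set μ.support) :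
    supportMeasure μ s = μ (Subtype.val '' s) :=
  comap_subtype_coe_apply (measurableSet_support μ) μ s

/-- The push-forward of `μ|_{supp μ}` to `Z` is the restriction of `μ` to its support.
[folklore] -/
theorem map_val_supportMeasure_eq_restrict (μ : Measure Z) :
    (supportMeasure μ).map Subtype.val = μ.restrict μ.support :=
  map_comap_subtype_coe (measurableSet_support μ) μ

section SecondCountable

variable [SecondCountableTopology Z]

omit [BorelSpace Z] in
/-- On a second-countable (hereditarily Lindelöf) space, `μ`-a.e. point lies in `supp μ`
(`Measure.support_mem_ae`). [folklore] -/
theorem ae_mem_support (μ : Measure Z) : ∀ᵐ x ∂μ, x ∈ μ.support :=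
  Filter.eventually_mem_set.2 Measure.support_mem_ae

omit [BorelSpace Z] in
/-- On a second-countable space, restricting `μ` to its support does not change it. [folklore] -/
theorem restrict_support (μ : Measure Z) : μ.restrict μ.support = μ :=
  Measure.restrict_eq_self_of_ae_mem (ae_mem_support μ)

/-- **`μ|_{supp μ}` pushes forward to `μ`** under the inclusion `supp μ → Z` (on a second-countable
space the complement of the support is `μ`-null, `Measure.measure_compl_support`): the inclusion is
an isometry of metric measure spaces `(supp μ, d|, μ|) → (Z, d, μ)` onto the support in the sense of
Bamler 2023, §2.3. [cite: Bamler2023, §2.3 (isometries between metric measure spaces)] -/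
theorem map_val_supportMeasure (μ : Measure Z) : (supportMeasure μ).map Subtype.val = μ := by
  rw [map_val_supportMeasure_eq_restrict, restrict_support]

/-- Integration against `μ|_{supp μ}` is integration against `μ`. [folklore] -/
theorem lintegral_supportMeasure (μ : Measure Z) (f : Z → ℝ≥0∞) :
    ∫⁻ x, f x.1 ∂(supportMeasure μ) = ∫⁻ z, f z ∂μ := by
  rw [supportMeasure, lintegral_subtype_comap (measurableSet_support μ), restrict_support]

/-- A property holds `μ|_{supp μ}`-a.e. iff it holds `μ`-a.e. [folklore] -/
theorem ae_supportMeasure_iff (μ : Measure Z) {p : Z → Prop} :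
    (∀ᵐ x ∂(supportMeasure μ), p x.1) ↔ ∀ᵐ z ∂μ, p z := by
  rw [supportMeasure, ← ae_restrict_iff_subtype (measurableSet_support μ), restrict_support]

/-- `μ|_{supp μ}` has the same total mass as `μ`. [folklore] -/
theorem supportMeasure_univ (μ : Measure Z) : supportMeasure μ univ = μ univ :=
  calc supportMeasure μ univ = (supportMeasure μ).map Subtype.val univ := by
        rw [Measure.map_apply measurable_subtype_coe MeasurableSet.univ, preimage_univ]
    _ = μ univ := by rw [map_val_supportMeasure]

/-- `μ|_{supp μ}` is finite if `μ` is. [folklore] -/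
instance isFiniteMeasure_supportMeasure (μ : Measure Z) [IsFiniteMeasure μ] :
    IsFiniteMeasure (supportMeasure μ) :=
  ⟨by rw [supportMeasure_univ]; exact measure_lt_top μ univ⟩

/-- `μ|_{supp μ}` is a probability measure if `μ` is: `(supp μ, d|, μ|)` is a (normalized) metric
measure space. [cite: Bamler2023, §2.3 (metric measure spaces of full support)] -/
instance isProbabilityMeasure_supportMeasure (μ : Measure Z) [IsProbabilityMeasure μ] :
    IsProbabilityMeasure (supportMeasure μ) :=
  ⟨by rw [supportMeasure_univ, measure_univ]⟩

/-- **`(supp μ, d|_{supp μ}, μ|_{supp μ})` has full support**: every nonempty open subset of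
`supp μ` has positive `μ|_{supp μ}`-measure (`Measure.IsOpenPosMeasure`, the condition
`supp μ_t = 𝒳_t` of metric flow pairs). An open subset of the subtype is `supp μ ∩ V` with `V`
open in `Z`; if it contains a point `x ∈ supp μ` then `0 < μ V = μ (supp μ ∩ V)`.
[cite: Bamler2023, §2.3 (metric measure spaces of full support)] -/
instance isOpenPosMeasure_supportMeasure (μ : Measure Z) : (supportMeasure μ).IsOpenPosMeasure := by
  refine ⟨fun U hU hne ↦ ?_⟩
  obtain ⟨V, hV, rfl⟩ := isOpen_induced_iff.1 hU
  obtain ⟨x, hx⟩ := hne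
  have hpos : 0 < μ V := (Measure.mem_support_iff_forall x.1).1 x.2 V (hV.mem_nhds hx)
  rw [supportMeasure_apply, Subtype.image_preimage_coe, inter_comm,
    measure_inter_conull Measure.measure_compl_support]
  exact hpos.ne'

end SecondCountable

/-! ### Invariance of the Gromov–`W₁`–Wasserstein distance -/

/-- **Passing to the support does not change `d_{GW₁}`**:
`d_{GW₁}((X, ν), (supp μ, d|_{supp μ}, μ|_{supp μ})) = d_{GW₁}((X, ν), (Z, μ))` for a probability
measure `μ` on a second-countable metric space `Z` (Bamler 2023, §2.4, proof of the Proposition: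
`d_{GW_p}((X, d, μ), (supp μ, d|_{supp μ}, μ|_{supp μ})) = 0`, here in the form usable without the
triangle inequality). `≤`: an admissible pair `φ : X → W`, `ψ : Z → W` gives the admissible pair
`φ`, `ψ ∘ Subtype.val` with the same push-forwards (`map_val_supportMeasure`). `≥`: given
`φ : X → W`, `ψ' : supp μ → W`, glue `W` and `Z` along `supp μ` (`Metric.GlueSpace`, Bamler's
Lemma (combining isometric embeddings)); `Z` then embeds into the glued space extending `ψ'`, and
`d_{W₁}` does not increase under the embedding of `W` (`wassersteinW1_map_le_of_edist_le`).
[cite: Bamler2023, §2.4, Proposition (d_{GW_p} is a pseudometric), proof] -/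
theorem gromovW1_supportMeasure {X : Type u} [MetricSpace X] [MeasurableSpace X] [BorelSpace X]
    [SecondCountableTopology Z] (ν : Measure X) (μ : Measure Z) [IsProbabilityMeasure μ] :
    gromovW1 ν (supportMeasure μ) = gromovW1 ν μ := by
  have hval : Isometry (Subtype.val : μ.support → Z) := isometry_subtype_coe
  refine le_antisymm ?_ (le_gromovW1 fun W _ _ _ φ ψ hφ hψ ↦ ?_)
  · -- `≤`: compose the embeddings of `Z` with the inclusion of the support
    rw [gromovW1_comm ν (supportMeasure μ), gromovW1_comm ν μ]
    have h := gromovW1_le_gromovW1_map hval (supportMeasure μ) ν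
    rwa [map_val_supportMeasure] at h
  · -- `≥`: glue the comparison space `W` and `Z` along the support
    letI : MeasurableSpace (Metric.GlueSpace hψ hval) := borel _
    haveI : BorelSpace (Metric.GlueSpace hψ hval) := ⟨rfl⟩
    have hL : Isometry (Metric.toGlueL hψ hval) := Metric.toGlueL_isometry hψ hval
    have hR : Isometry (Metric.toGlueR hψ hval) := Metric.toGlueR_isometry hψ hval
    have hLm : Measurable (Metric.toGlueL hψ hval) := hL.continuous.measurable
    have hRm : Measurable (Metric.toGlueR hψ hval) := hR.continuous.measurable
    calc gromovW1 ν μ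
        ≤ wassersteinW1 (ν.map (Metric.toGlueL hψ hval ∘ φ)) (μ.map (Metric.toGlueR hψ hval)) :=
          gromovW1_le_wassersteinW1_map ν μ (hL.comp hφ) hR
      _ = wassersteinW1 ((ν.map φ).map (Metric.toGlueL hψ hval))
            (((supportMeasure μ).map ψ).map (Metric.toGlueL hψ hval)) := by
          rw [Measure.map_map hLm hφ.continuous.measurable,
            Measure.map_map hLm hψ.continuous.measurable, Metric.toGlue_commute hψ hval,
            ← Measure.map_map hRm measurable_subtype_coe, map_val_supportMeasure]
      _ ≤ wassersteinW1 (ν.map φ) ((supportMeasure μ).map ψ) :=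
          wassersteinW1_map_le_of_edist_le hLm (fun a b ↦ (hL.edist_eq a b).le) _ _

/-- `d_{GW₁}((supp μ, μ|_{supp μ}), (X, ν)) = d_{GW₁}((Z, μ), (X, ν))` (the symmetric form of
`gromovW1_supportMeasure`). [cite: Bamler2023, §2.4, Proposition (d_{GW_p} is a pseudometric), proof] -/
theorem gromovW1_supportMeasure_left {X : Type u} [MetricSpace X] [MeasurableSpace X]
    [BorelSpace X] [SecondCountableTopology Z] (μ : Measure Z) [IsProbabilityMeasure μ]
    (ν : Measure X) : gromovW1 (supportMeasure μ) ν = gromovW1 μ ν := by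
  rw [gromovW1_comm (supportMeasure μ) ν, gromovW1_supportMeasure, gromovW1_comm]

end Borel

end SupportSpace

end Literature.Geometry.Riemannian

end
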